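import Summits.MatrixMultiplication.OmegaCensus.USPClassifyKit
import HarnessLib

/-!
# ω-census, family (b′) STPP / USP: kernel kit for classifying (strong) USPs of width 4 — II: refutations, words, packed data

HONEST FRAMING (pub-omega census; verbatim): lottery ticket; floor = certified bounds/negative ranges.
Census BOOKKEEPING machinery; no value of `ω` is touched here.  Continues `USPClassifyKit.lean`:

* silence of a code triple (`silent`: no column with exactly two / at least two of `·=1, ·=2, ·=3`) and refutation of a code list by a
  witness numeral `w < 2^48` packing `σ, τ : [8] → [8]` (3 bits a value; `validWit n w`: permutations of `range n`, not both the
  identity; `refW`): `not_pz_of_refW` — take `π₁ = 1, π₂ = σ, π₃ = τ` in CKSU's definition; the three 2-row witnesses `badPairB` and a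
  checked `81 × 81` bit table of bad pairs (`pairTabOK`, `badPairB_of_tab`);
* words in the group (`actW`, `OkW`, `PZ.mapW`) and the classification predicate `Classified st s L` ("every (strong) USP list of `s`
  distinct codes is carried by a word onto the set of a listed class"), `classified_zero`, and the exits `not_pz_of_classified_nil`,
  `not_pt_of_classified_nil` (an empty list at level `m` excludes `m`-row puzzles);
* packed data access: code lists 7 bits a code (`cd`, `codesOf`), classes of a level in one numeral (`getClassP`, `Lcls`), witness
  tables (`getWitP`), well-formed classes (`goodClassP`).
-/

namespace Summit.MatrixMultiplication.OmegaCensus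

open Literature.Computability.AlgebraicComplexity Equiv

namespace W4

/-! ## Silence and refutations -/

/-- Boolean coordinate test on natural-number symbols. [cite: CohnKleinbergSzegedyUmans2005, §3 (p. 5)] -/
def tstN (st : Bool) (x y z : ℕ) : Bool :=
  if st then (x == 0 && y == 1 && !(z == 2)) || (x == 0 && !(y == 1) && z == 2) || (!(x == 0) && y == 1 && z == 2)
  else (x == 0 && y == 1) || (x == 0 && z == 2) || (y == 1 && z == 2)

/-- `tstN` agrees with `tst` on symbols. [folklore] -/
theorem tstN_iff (st : Bool) (a b c : Fin 3) : tstN st a.val b.val c.val = true ↔ tst st a b c := by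
  revert st a b c; decide

/-- The code triple `(c₁, c₂, c₃)` is SILENT: no column passes the coordinate test. [folklore] -/
def silent (st : Bool) (c₁ c₂ c₃ : ℕ) : Bool :=
  !tstN st (c₁ / 1 % 3) (c₂ / 1 % 3) (c₃ / 1 % 3) && !tstN st (c₁ / 3 % 3) (c₂ / 3 % 3) (c₃ / 3 % 3) &&
    !tstN st (c₁ / 9 % 3) (c₂ / 9 % 3) (c₃ / 9 % 3) && !tstN st (c₁ / 27 % 3) (c₂ / 27 % 3) (c₃ / 27 % 3)

/-- A silent code triple has no column passing the test. [folklore] -/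
theorem not_tst_of_silent {st : Bool} {c₁ c₂ c₃ : ℕ} (h : silent st c₁ c₂ c₃ = true) (i : Fin 4) :
    ¬ tst st (rowOfCode c₁ i) (rowOfCode c₂ i) (rowOfCode c₃ i) := by
  rw [← tstN_iff]
  simp only [silent, Bool.and_eq_true, Bool.not_eq_true'] at h
  obtain ⟨⟨⟨h0, h1⟩, h2⟩, h3⟩ := h
  fin_cases i
  · exact fun hx => Bool.noConfusion (h0.symm.trans hx)
  · exact fun hx => Bool.noConfusion (h1.symm.trans hx)
  · exact fun hx => Bool.noConfusion (h2.symm.trans hx)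
  · exact fun hx => Bool.noConfusion (h3.symm.trans hx)

/-- `σ u` from the witness numeral `w` (3 bits at position `3u`). [folklore] -/
def sg (w u : ℕ) : ℕ := (w >>> (3 * u)) &&& 7

/-- `τ u` from the witness numeral `w` (3 bits at position `24 + 3u`). [folklore] -/
def tg (w u : ℕ) : ℕ := (w >>> (24 + 3 * u)) &&& 7

/-- `w` codes a pair of permutations of `range n` (values `< n`, onto by their bit sets), not both the identity. [folklore] -/
def validWit (n w : ℕ) : Bool :=
  allBelow n (fun u => decide (sg w u < n) && decide (tg w u < n)) &&
  (bitsOf (sg w) n == 2 ^ n - 1) && (bitsOf (tg w) n == 2 ^ n - 1) &&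
  !(allBelow n fun u => sg w u == u && tg w u == u)

/-- The witness `w` refutes the code list `C`: every row moved by `σ` or `τ` gives a silent triple `(C[u], C[σu], C[τu])`. [folklore] -/
def refW (st : Bool) (C : List ℕ) (w : ℕ) : Bool :=
  (List.range C.length).all fun u =>
    (sg w u == u && tg w u == u) || silent st (C.getD u 0) (C.getD (sg w u) 0) (C.getD (tg w u) 0)

/-- A map `Fin n → Fin n` reading values from a digit function, defaulting to the identity where out of range. [folklore] -/
def finOfDigits (n : ℕ) (d : ℕ → ℕ) (u : Fin n) : Fin n := if h : d u.val < n then ⟨d u.val, h⟩ else u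

/-- In range, `finOfDigits` reads the digit. [folklore] -/
theorem finOfDigits_val {n : ℕ} {d : ℕ → ℕ} {u : Fin n} (h : d u.val < n) : (finOfDigits n d u).val = d u.val := by
  unfold finOfDigits; rw [dif_pos h]

/-- **Refutation soundness**: a valid witness that refutes `C` shows `C` is no (strong) USP — take `π₁ = 1, π₂ = σ, π₃ = τ` in the
definition; unmoved rows give constant triples, moved rows silent ones. [cite: CohnKleinbergSzegedyUmans2005, §3 (p. 5)] -/
theorem not_pz_of_refW {st : Bool} {C : List ℕ} {w : ℕ} (hv : validWit C.length w = true) (hr : refW st C w = true) :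
    ¬ PZ st C := by
  intro hP
  set n := C.length with hn
  simp only [validWit, Bool.and_eq_true, beq_iff_eq, Bool.not_eq_true'] at hv
  obtain ⟨⟨⟨hlt, hsσ⟩, hsτ⟩, hnid⟩ := hv
  rw [allBelow_iff] at hlt
  have hlt' : ∀ u < n, sg w u < n ∧ tg w u < n := fun u hu => by
    have := hlt u hu; simp only [Bool.and_eq_true, decide_eq_true_eq] at this; exact this
  let fσ : Fin n → Fin n := finOfDigits n (sg w)
  let fτ : Fin n → Fin n := finOfDigits n (tg w)
  have hfσ : ∀ u : Fin n, (fσ u).val = sg w u.val := fun u => finOfDigits_val (hlt' u.val u.isLt).1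
  have hfτ : ∀ u : Fin n, (fτ u).val = tg w u.val := fun u => finOfDigits_val (hlt' u.val u.isLt).2
  have hσsurj : Function.Surjective fσ := fun v => by
    obtain ⟨u, hu, huv⟩ := exists_eq_of_bitsOf hsσ v.isLt
    exact ⟨⟨u, hu⟩, Fin.ext ((hfσ _).trans huv)⟩
  have hτsurj : Function.Surjective fτ := fun v => by
    obtain ⟨u, hu, huv⟩ := exists_eq_of_bitsOf hsτ v.isLt
    exact ⟨⟨u, hu⟩, Fin.ext ((hfτ _).trans huv)⟩
  let σ : Perm (Fin n) := Equiv.ofBijective fσ ⟨Finite.injective_iff_surjective.2 hσsurj, hσsurj⟩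
  let τ : Perm (Fin n) := Equiv.ofBijective fτ ⟨Finite.injective_iff_surjective.2 hτsurj, hτsurj⟩
  rcases hP 1 σ τ with ⟨h1, h2⟩ | ⟨u, i, hx⟩
  · have hnid' : ¬ ((allBelow n fun u => sg w u == u && tg w u == u) = true) := by rw [hnid]; decide
    rw [allBelow_iff] at hnid'
    simp only [not_forall, exists_prop] at hnid'
    obtain ⟨u, hu, hne⟩ := hnid'
    have hσu : sg w u = u := by
      have := congrArg (fun π : Perm (Fin n) => (π ⟨u, hu⟩).val) h1
      simpa [σ, hfσ] using this.symm
    have hτu : tg w u = u := by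
      have := congrArg (fun π : Perm (Fin n) => (π ⟨u, hu⟩).val) (h1.trans h2)
      simpa [τ, hfτ] using this.symm
    exact hne (by simp [hσu, hτu])
  · simp only [refW, List.all_eq_true, List.mem_range, Bool.or_eq_true, Bool.and_eq_true, beq_iff_eq] at hr
    have hσu : (σ u).val = sg w u.val := hfσ u
    have hτu : (τ u).val = tg w u.val := hfτ u
    rcases hr u.val u.isLt with ⟨h1, h2⟩ | hsil
    · have e1 : σ u = u := Fin.ext (hσu.trans h1)
      have e2 : τ u = u := Fin.ext (hτu.trans h2)
      rw [Perm.one_apply, e1, e2] at hx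
      exact not_tst_self st _ hx
    · have hrow : ∀ v : Fin n, rowsOf C v = rowOfCode (C.getD v.val 0) := fun v => rfl
      rw [Perm.one_apply, hrow, hrow, hrow, hσu, hτu] at hx
      exact not_tst_of_silent hsil i hx

/-- The three 2-row witnesses `(σ, τ) = ((0 1), 1), (1, (0 1)), ((0 1), (0 1))` as numerals. [folklore] -/
def pairWits : List ℕ := [1 + 2 ^ 27, 2 ^ 3 + 2 ^ 24, 1 + 2 ^ 24]

/-- The pair `{a, b}` is NOT a (strong) USP, by one of the three 2-row witnesses. [folklore] -/
def badPairB (st : Bool) (a b : ℕ) : Bool := pairWits.any (refW st [a, b])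

/-- The three pair witnesses are valid. [folklore] -/
theorem pairWits_valid : pairWits.all (validWit 2) = true := by decide +kernel

/-- A bad pair is no (strong) USP. [folklore] -/
theorem not_pz_of_badPairB {st : Bool} {a b : ℕ} (h : badPairB st a b = true) : ¬ PZ st [a, b] := by
  unfold badPairB at h
  obtain ⟨w, hw, hr⟩ := List.any_eq_true.1 h
  exact not_pz_of_refW (List.all_eq_true.1 pairWits_valid w hw) hr

/-- A bit table `T` of bad pairs is correct: bit `81a + b` set only if `badPairB st a b`. [folklore] -/
def pairTabOK (st : Bool) (T : ℕ) : Bool :=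
  (List.range 81).all fun a => (List.range 81).all fun b => !T.testBit (81 * a + b) || badPairB st a b

/-- Reading a correct pair table. [folklore] -/
theorem badPairB_of_tab {st : Bool} {T : ℕ} (hT : pairTabOK st T = true) {a b : ℕ} (ha : a < 81) (hb : b < 81)
    (h : T.testBit (81 * a + b) = true) : badPairB st a b = true := by
  simp only [pairTabOK, List.all_eq_true, List.mem_range, Bool.or_eq_true, Bool.not_eq_true'] at hT
  rcases hT a ha b hb with h' | h'
  · rw [h] at h'; exact absurd h' (by decide)
  · exact h'


/-! ## Words in the group and the classification predicate -/

/-- Apply a word of group elements (head first) to a code. [folklore] -/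
def actW : List (ℕ × ℕ) → ℕ → ℕ
  | [], c => c
  | g :: gs, c => actW gs (actCode g.1 g.2 c)

/-- All letters of the word are genuine group elements (`p < 6`, `q < 24`). [folklore] -/
def OkW (gs : List (ℕ × ℕ)) : Prop := ∀ g ∈ gs, g.1 < 6 ∧ g.2 < 24

/-- Appending a letter applies it last. [folklore] -/
theorem actW_append (gs : List (ℕ × ℕ)) (g : ℕ × ℕ) (c : ℕ) : actW (gs ++ [g]) c = actCode g.1 g.2 (actW gs c) := by
  induction gs generalizing c with
  | nil => rfl
  | cons g' gs ih => exact ih _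

/-- Words keep codes `< 81`. [folklore] -/
theorem actW_lt {gs : List (ℕ × ℕ)} (hgs : OkW gs) {c : ℕ} (hc : c < 81) : actW gs c < 81 := by
  induction gs generalizing c with
  | nil => exact hc
  | cons g gs ih =>
    exact ih (fun g' hg' => hgs g' (List.mem_cons_of_mem _ hg')) (actCode_lt (hgs g (by simp)).1 (hgs g (by simp)).2 hc)

/-- Words act injectively on codes `< 81`. [folklore] -/
theorem actW_inj {gs : List (ℕ × ℕ)} (hgs : OkW gs) {c c' : ℕ} (hc : c < 81) (hc' : c' < 81) (h : actW gs c = actW gs c') :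
    c = c' := by
  induction gs generalizing c c' with
  | nil => exact h
  | cons g gs ih =>
    have hg := hgs g (by simp)
    have hgs' : OkW gs := fun g' hg' => hgs g' (List.mem_cons_of_mem _ hg')
    exact actCode_inj hg.1 hg.2 hc hc' (ih hgs' (actCode_lt hg.1 hg.2 hc) (actCode_lt hg.1 hg.2 hc') h)

/-- Words preserve (strong) USP lists. [cite: AndersonJiXu2020, §7 (Table 3, equivalence classes; arXiv:2301.00074v1)] -/
theorem PZ.mapW {st : Bool} {gs : List (ℕ × ℕ)} (hgs : OkW gs) {C : List ℕ} (h : PZ st C) (hC : ∀ x ∈ C, x < 81) :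
    PZ st (C.map (actW gs)) := by
  induction gs generalizing C with
  | nil =>
    have e : C.map (actW []) = C := by
      rw [show actW [] = id from funext fun c => rfl, List.map_id]
    rw [e]; exact h
  | cons g gs ih =>
    have hg := hgs g (by simp)
    have hgs' : OkW gs := fun g' hg' => hgs g' (List.mem_cons_of_mem _ hg')
    have e : C.map (actW (g :: gs)) = (C.map (actCode g.1 g.2)).map (actW gs) := by
      rw [List.map_map]; rfl
    rw [e]
    refine ih hgs' (h.map hC hg.1 hg.2) fun x hx => ?_
    obtain ⟨y, hy, rfl⟩ := List.mem_map.1 hx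
    exact actCode_lt hg.1 hg.2 (hC y hy)

/-- **Classified up to symmetry**: every (strong) USP list of `s` distinct codes `< 81` is carried by some word of `G` onto (the set of)
a listed class. [cite: AndersonJiXu2020, §7 (Table 3, equivalence classes; arXiv:2301.00074v1)] -/
def Classified (st : Bool) (s : ℕ) (L : List (List ℕ)) : Prop :=
  ∀ C : List ℕ, C.length = s → C.Nodup → (∀ x ∈ C, x < 81) → PZ st C →
    ∃ gs : List (ℕ × ℕ), OkW gs ∧ ∃ T ∈ L, ∀ y, y ∈ C.map (actW gs) ↔ y ∈ T

/-- Level 0: the empty puzzle is the only 0-row puzzle. [folklore] -/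
theorem classified_zero (st : Bool) : Classified st 0 [[]] := by
  intro C hC _ _ _
  rw [List.length_eq_zero_iff] at hC
  subst hC
  exact ⟨[], fun g hg => by simp at hg, [], by simp, fun y => by simp⟩

/-- An empty class list at level `s` means: no (strong) USP list of `s` distinct codes. [folklore] -/
theorem not_pz_of_classified_nil {st : Bool} {s : ℕ} (h : Classified st s []) {C : List ℕ} (hl : C.length = s) (hnd : C.Nodup)
    (hC : ∀ x ∈ C, x < 81) : ¬ PZ st C := fun hP => by
  obtain ⟨gs, -, T, hT, -⟩ := h C hl hnd hC hP
  simp at hT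

/-- From rows to code lists: an injective family of `m` rows of width 4 with property `PT st` gives a `PZ st` list of `m` distinct
codes `< 81`; so an empty class list at level `m` excludes such families. [folklore] -/
theorem not_pt_of_classified_nil {st : Bool} {m : ℕ} (h : Classified st m []) (row : Fin m → Fin 4 → Fin 3)
    (hinj : Function.Injective row) : ¬ PT st row := by
  intro hP
  let C : List ℕ := List.ofFn fun u => codeOf (row u)
  have hlen : C.length = m := List.length_ofFn
  have hnd : C.Nodup := List.nodup_ofFn.2 (codeOf_injective.comp hinj)
  have hC : ∀ x ∈ C, x < 81 := fun x hx => by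
    obtain ⟨u, rfl⟩ := (List.mem_ofFn' _ _).1 hx
    exact codeOf_lt _
  refine not_pz_of_classified_nil h hlen hnd hC ?_
  have hre := hP.restrict (Fin.cast hlen) (Fin.cast_injective hlen)
  have hrows : rowsOf C = fun u i => row (Fin.cast hlen u) i := by
    funext u i
    simp only [rowsOf, C, List.getD_eq_getElem _ _ u.isLt, List.getElem_ofFn, rowOfCode_codeOf]
    rfl
  unfold PZ; rw [hrows]; exact hre

/-! ## Certificate data access (packed numerals) and the level checker

Everything the kernel iterates over is a natural-number numeral read by shifts and masks (GMP-backed in the kernel); lists are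
avoided in the hot loops. -/

/-- Code number `u` of a packed code list (7 bits a code, code `u` at bit `7u`). [folklore] -/
def cd (P u : ℕ) : ℕ := (P >>> (7 * u)) &&& 127

/-- The first `n` codes of a packed code list, as a list. [folklore] -/
def codesOf (P n : ℕ) : List ℕ := (List.range n).map (cd P)

/-- Length of `codesOf`. [folklore] -/
theorem length_codesOf (P n : ℕ) : (codesOf P n).length = n := by simp [codesOf]

/-- Members of `codesOf`. [folklore] -/
theorem mem_codesOf {P n y : ℕ} : y ∈ codesOf P n ↔ ∃ u < n, cd P u = y := by
  simp [codesOf, List.mem_map, List.mem_range]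

/-- Entries of `codesOf`. [folklore] -/
theorem getD_codesOf {P n u : ℕ} (hu : u < n) : (codesOf P n).getD u 0 = cd P u := by
  rw [codesOf, List.getD_eq_getElem _ _ (by simpa using hu)]
  simp

/-- Class number `j` of a level whose classes have `s` codes: the `7s` bits at position `7sj` of the level numeral. [folklore] -/
def getClassP (CLS s j : ℕ) : ℕ := (CLS >>> (7 * s * j)) &&& (2 ^ (7 * s) - 1)

/-- The list of the first `N` classes (as code lists). [folklore] -/
def Lcls (CLS s N : ℕ) : List (List ℕ) := (List.range N).map fun j => codesOf (getClassP CLS s j) s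

/-- Witness number `k` of a packed witness table (48 bits each). [folklore] -/
def getWitP (WT k : ℕ) : ℕ := (WT >>> (48 * k)) &&& (2 ^ 48 - 1)

/-- A packed class of `s` codes is strictly increasing with codes `< 81`. [folklore] -/
def goodClassP (P s : ℕ) : Bool :=
  allBelow s fun m => decide (cd P m < 81) && (decide (m + 1 = s) || decide (cd P m < cd P (m + 1)))

/-- A good packed class decodes to a list without repetition, of codes `< 81`. [folklore] -/
theorem goodClassP_spec {P s : ℕ} (h : goodClassP P s = true) :
    (codesOf P s).Nodup ∧ ∀ x ∈ codesOf P s, x < 81 := by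
  rw [goodClassP, allBelow_iff] at h
  have hlt : ∀ m < s, cd P m < 81 := fun m hm => by
    have := h m hm; simp only [Bool.and_eq_true, decide_eq_true_eq] at this; exact this.1
  have hstep : ∀ m, m + 1 < s → cd P m < cd P (m + 1) := fun m hm => by
    have := h m (by omega)
    simp only [Bool.and_eq_true, Bool.or_eq_true, decide_eq_true_eq] at this
    rcases this.2 with h' | h'
    · omega
    · exact h'
  have hmono : ∀ u v, u < v → v < s → cd P u < cd P v := by
    intro u v huv hv
    induction v with
    | zero => omega
    | succ v ih =>
      rcases Nat.lt_succ_iff_lt_or_eq.1 huv with h' | rfl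
      · exact lt_trans (ih h' (by omega)) (hstep v hv)
      · exact hstep u hv
  refine ⟨?_, fun x hx => ?_⟩
  · rw [codesOf, List.nodup_map_iff_inj_on (List.nodup_range)]
    intro u hu v hv huv
    rw [List.mem_range] at hu hv
    rcases lt_trichotomy u v with h' | h' | h'
    · exact absurd huv (ne_of_lt (hmono u v h' hv))
    · exact h'
    · exact absurd huv (ne_of_gt (hmono v u h' hu))
  · obtain ⟨u, hu, rfl⟩ := mem_codesOf.1 hx
    exact hlt u hu

end W4

end Summit.MatrixMultiplication.OmegaCensus
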